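import Summits.BirchSwinnertonDyer.BirchSwinnertonDyer.Theorems.UniversalToricDescentStrictPlaceLocalCount
import Literature.NumberTheory.IwasawaTheory.Greenberg2006.LocalEulerPoincareCorank
import HarnessLib

/-!
# The TAME local count at a layer of a `ℤ_p`-tower: `#H¹(G_n, E[p^∞])[p^k] ≤ #E[p^∞]^{G_n}[p^k]` whenever `E[p^∞]^{G_n}` is
# finite (crux ♭T≤ stmt-BirchSwinnertonDyer-23042, line `sigmacongruence`, stub R3 `stub_localTorsionCountAtTame`, brick (T))

Width prover `bsd-wall-utd-p1-w2` g1 under lead `bsd-wall-utd-p1` g18 (`--supports stmt-BirchSwinnertonDyer-23042`, helper). THEOREMS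
ONLY (no definition, no named fact, no `sorry`). BSD is not proved by any of this.

For `W/K` elliptic over a number field, a prime `p`, ANY `ℤ_p`-extension `κ`, a finite place `v ∤ p`, and a LAYER subgroup
`G_n = {g ∈ D_v : p^{c+n} ∣ κ g}` of the decomposition group (given by its characterisation `hGn`, no definition), with
`A = E[p^∞]`: **if `A^{G_n}` is finite then `H¹(G_n, A)[p^k]` is finite and `#H¹(G_n, A)[p^k] ≤ #A^{G_n}[p^k]`** (`k ≥ 0`).
Chain (every input a tree theorem; this is the strict-place assembly `…StrictPlaceLocalCount.strictPlace_localCount` with the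
tower-wide finiteness `LocalTowerTorsionFiniteAt` replaced by the finiteness of `A^{G_n}` at ONE layer, and the `𝒪`-factor `= 1`):
* Kummer at level `p^k` over `G_n ≤ D_v ≤ Γ_K`, EXACT: `#H¹(G_n, E[p^k]) = #H¹(G_n, A)[p^k] · #(A^{G_n}/p^k)`
  (`…KummerPow.natCard_ker_kummerPow_eq_natCard_quotient`, `exists_resH1Hom_torsionPow_eq_nested`,
  `pow_smul_resH1Hom_torsionPow_nested_eq_zero`) and `#(A^{G_n}/p^k) = #A^{G_n}[p^k]` (finite `A^{G_n}`,
  `…LocalKummerKernel.natCard_quotient_eq_natCard_pTorsion_of_finite`);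
* the bridge `H¹(G_n, E[p^k]) ≃ H¹(N_n, E[p^k])` to the avatar `N_n ≤ Γ_{K_v}` of `G_n` (`…StrictPlaceLocalCount.nonempty_equiv_local`);
* Tate's local count as an UPPER bound (Shapiro to `K_v` + Euler–Poincaré + Weil), `…LocalShapiroCount.natCard_H1_subgroup_torsion_bounds`:
  `#H¹(N_n, E[p^k]) ≤ t² · #(𝒪_v/p^{2k[Γ:N_n]})` with `t = #A^{G_n}[p^k] ≥ #E[p^k]^{N_n}`, and `#(𝒪_v/p^j) = 1` at `v ∤ p`
  (`Greenberg2006.natCard_adicCompletionIntegers_quotient_natCast_of_not_mem`).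
Hence `#H¹(G_n, A)[p^k] · t ≤ t²`. This is the layer-`n` term of Greenberg–Vatsal's `#H¹(L, E[p^∞])[p^k] = #E(L)[p^k]` at
`L = K_{n,w}`, `w ∣ v ∤ p`. [GreenbergVatsal2000, §2 Prop. (2.4) and proof (p. 22)]; [MilneADT2006, I Thm. 2.8, Cor. 2.3].
-/

set_option autoImplicit false
-- the Theorems namespace of this sub repeats the summit name by design (D-0017 nested layout)
set_option linter.dupNamespace false

noncomputable section

open scoped Classical ValuativeRel
open Function Field NumberField IsDedekindDomain WeierstrassCurve
open Literature.NumberTheory.GaloisRepresentations Literature.NumberTheory.EllipticCurves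
  Literature.NumberTheory.EllipticCurves.GreenbergSelmer
  Summit.BirchSwinnertonDyer.Rank1Residual Summit.BirchSwinnertonDyer.Rank1Residual.X11b
  Summit.BirchSwinnertonDyer.Rank1Residual.X11b.Coinv Summit.BirchSwinnertonDyer.Rank1Residual.X11b.ProcyclicDescent
  Summit.BirchSwinnertonDyer.BirchSwinnertonDyer.Theorems
  Summit.BirchSwinnertonDyer.BirchSwinnertonDyer.Theorems.UniversalToricDescentStrictPlaceLocalCount
open Literature.Barriers.BirchSwinnertonDyer (geomTorsion_pow_le_geomPrimaryTorsion)

universe u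

namespace Summit.BirchSwinnertonDyer.BirchSwinnertonDyer.Theorems.UniversalToricDescentTameLayerCount

variable {K : Type} [Field K] [NumberField K] (W : WeierstrassCurve K) [W.IsElliptic] (p : ℕ) [Fact p.Prime]
  (κ : ZpExtension K p) (v : HeightOneSpectrum (𝓞 K))

/-- `#(𝓞_v / p^j) = 1` at a place `v ∤ p`, in the currency `𝒪[K_v] ⧸ ((p^j : ℕ) : 𝒪[K_v])` of `…LocalShapiroCount`
(`p` is a unit of `𝓞_v`). [cite: Greenberg2006, §4 A Prop. 4.2 (b)] -/
theorem natCard_integer_quotient_pow_eq_one (hpv : ((p : ℕ) : 𝓞 K) ∉ v.asIdeal) (j : ℕ) :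
    Nat.card (𝒪[v.adicCompletion K] ⧸ Ideal.span {((p ^ j : ℕ) : 𝒪[v.adicCompletion K])}) = 1 := by
  rw [natCard_integer_quotient_natCast_eq K v,
    Summit.BirchSwinnertonDyer.Rank1Residual.Additive.DefectCountFiniteLevel.natCard_quot_adicCompletionIntegers_natCast_pow
      v (Fact.out : p.Prime).ne_zero,
    Literature.NumberTheory.IwasawaTheory.Greenberg2006.natCard_adicCompletionIntegers_quotient_natCast_of_not_mem K v p hpv,
    pow_zero, one_pow]

/-- **The tame layer count (brick (T) of R3).** For a layer `G_n = {g ∈ D_v : p^{c+n} ∣ κ g}` of the decomposition group at a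
place `v ∤ p` with `E[p^∞]^{G_n}` FINITE: `H¹(G_n, E[p^∞])[p^k]` is finite and `#H¹(G_n, E[p^∞])[p^k] ≤ #E[p^∞]^{G_n}[p^k]`.
See the module docstring for the chain (exact Kummer count, bridge to `Γ_{K_v}`, Tate's count as an upper bound, `𝒪`-factor `1`).
[cite: GreenbergVatsal2000, §2 Prop. (2.4) and proof (p. 22)] [cite: MilneADT2006, I Thm. 2.8, Cor. 2.3]
[cite: GreenbergLNM1716, §3 Lemma 3.1–3.3] -/
theorem finite_and_natCard_pow_torsion_subgroupH1_layer_le (hpv : ((p : ℕ) : 𝓞 K) ∉ v.asIdeal) {c n : ℕ}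
    {Gn : Subgroup (decomp (K := K) v)}
    (hGn : ∀ g : decomp (K := K) v, g ∈ Gn ↔ (p : ℤ_[p]) ^ (c + n) ∣ (κ (g : absoluteGaloisGroup K)).toAdd)
    [Finite (FixedPoints.addSubgroup Gn (W.geomPrimaryTorsion p))] (k : ℕ) :
    Finite {x : subgroupH1 Gn (W.geomPrimaryTorsion p) // p ^ k • x = 0} ∧
      Nat.card {x : subgroupH1 Gn (W.geomPrimaryTorsion p) // p ^ k • x = 0} ≤
        Nat.card {a : FixedPoints.addSubgroup Gn (W.geomPrimaryTorsion p) // p ^ k • a = 0} := by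
  have hp : p.Prime := Fact.out
  haveI : CompactSpace (absoluteGaloisGroup K) := absoluteGaloisGroup_compactSpace K
  haveI : CompactSpace (decomp (K := K) v) := isCompact_iff_compactSpace.mp (isClosed_decomp v).isCompact
  -- notation
  let A : Type := W.geomPrimaryTorsion p
  let G : Type := decomp (K := K) v
  let κ₀ : G →ₜ* Multiplicative ℤ_[p] := kappaD κ v
  have hκ₀ : ∀ g : G, κ₀ g = κ (g : absoluteGaloisGroup K) := fun _ ↦ rfl
  have hGn₀ : ∀ g : G, g ∈ Gn ↔ (p : ℤ_[p]) ^ (c + n) ∣ (κ₀ g).toAdd := hGn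
  let F : Type := v.adicCompletion K
  haveI : CharZero F := charZero_of_injective_algebraMap (algebraMap K F).injective
  haveI : CompactSpace (absoluteGaloisGroup F) := absoluteGaloisGroup_compactSpace F
  let π : absoluteGaloisGroup F →ₜ* absoluteGaloisGroup K := absGaloisRestrict K F
  let χ : absoluteGaloisGroup F →ₜ* Multiplicative ℤ_[p] := κ.toContinuousMonoidHom.comp π
  have hχ : ∀ σ, χ σ = κ (π σ) := fun _ ↦ rfl
  let eF := absGaloisRangeEquivCompletion K v
  -- the finite group `T = A^{G_n}` and its `p^k`-torsion count `t`
  let B := FixedPoints.addSubgroup Gn A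
  haveI : Finite {a : B // p ^ k • a = 0} := Subtype.finite
  haveI : Nonempty {a : B // p ^ k • a = 0} := ⟨⟨0, smul_zero _⟩⟩
  set t : ℕ := Nat.card {a : B // p ^ k • a = 0} with ht
  have htpos : 0 < t := Nat.card_pos
  -- the case `k = 0`
  rcases Nat.eq_zero_or_pos k with rfl | hk
  · have h1 : ∀ x : subgroupH1 Gn A, p ^ 0 • x = 0 ↔ x = 0 := fun x ↦ by rw [pow_zero, one_smul]
    haveI : Subsingleton {x : subgroupH1 Gn A // p ^ 0 • x = 0} :=
      ⟨fun a b ↦ Subtype.ext (((h1 a.1).mp a.2).trans ((h1 b.1).mp b.2).symm)⟩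
    refine ⟨Finite.of_subsingleton, ?_⟩
    rw [Nat.card_of_subsingleton (⟨0, smul_zero _⟩ : {x : subgroupH1 Gn A // p ^ 0 • x = 0})]
    exact htpos
  -- the local avatar `N_n ≤ Γ_F` of the layer
  obtain ⟨Nn, hNn⟩ := exists_layer χ (c + n)
  have hNn' : ∀ σ, σ ∈ Nn ↔ (p : ℤ_[p]) ^ (c + n) ∣ (κ (π σ)).toAdd := hNn
  haveI : Gn.Normal := UniversalToricDescentTowerDescent.normal_layer κ₀ hGn₀
  haveI : Nn.Normal := UniversalToricDescentTowerDescent.normal_layer χ hNn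
  have hNopen : IsOpen (Nn : Set (absoluteGaloisGroup F)) := isOpen_layer χ hNn
  haveI hNQ : Finite (absoluteGaloisGroup F ⧸ Nn) := Subgroup.quotient_finite_of_isOpen Nn hNopen
  -- Tate's count (upper bound) at the avatar
  obtain ⟨ρC, hρC⟩ := UniversalToricDescentLocalShapiroCount.exists_continuousRep_coind
    (GaloisRep.restrictField F (W.torsionGaloisModule (p ^ k : ℕ))) Nn hNopen
  have hfixle : Nat.card {T : WeierstrassCurve.geomTorsion W ((p ^ k : ℕ) : ℤ) //
      ∀ g : absoluteGaloisGroup F, g ∈ Nn → GaloisRep.restrictField F (W.torsionGaloisModule (p ^ k : ℕ)) g T = T} ≤ t := by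
    rw [ht]
    refine Nat.card_le_card_of_injective (fun T ↦ ⟨⟨AddSubgroup.inclusion (geomTorsion_pow_le_geomPrimaryTorsion W p k) T.1,
      fun g ↦ ?_⟩, ?_⟩) ?_
    · -- `g ∈ G_n`: `g = π σ` with `σ ∈ N_n`
      let σ : absoluteGaloisGroup F := eF.symm ⟨((g : G) : absoluteGaloisGroup K), (g : G).2⟩
      have hπσ : π σ = ((g : G) : absoluteGaloisGroup K) := absGaloisRestrict_absGaloisRangeEquivCompletion_symm K v _
      have hσ : σ ∈ Nn := by
        rw [hNn', hπσ, ← hκ₀]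
        exact (hGn₀ g).mp g.2
      have h1 := T.2 σ hσ
      change (π σ) • T.1 = T.1 at h1
      rw [hπσ] at h1
      exact congrArg (AddSubgroup.inclusion _) h1
    · -- `p^k`-torsion
      apply Subtype.ext
      change p ^ k • AddSubgroup.inclusion (geomTorsion_pow_le_geomPrimaryTorsion W p k) T.1 = 0
      rw [← map_nsmul, AddSubgroup.torsionBy.nsmul T.1, map_zero]
    · intro T₁ T₂ h
      have h' := congrArg (fun b : {a : B // p ^ k • a = 0} ↦ ((b.1 : A))) h
      exact Subtype.ext (AddSubgroup.inclusion_injective _ h')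
  obtain ⟨hLfin, -, hLup⟩ := UniversalToricDescentLocalShapiroCount.natCard_H1_subgroup_torsion_bounds W F p k hk Nn
    hNopen ρC hρC hfixle
  rw [natCard_integer_quotient_pow_eq_one p v hpv, mul_one] at hLup
  -- the bridge `H¹(G_n, E[p^k]) ≃ H¹(N_n, E[p^k])`
  haveI : NeZero (p ^ k : ℕ) := ⟨pow_ne_zero k hp.ne_zero⟩
  obtain ⟨eqv⟩ := nonempty_equiv_local W p κ v (p ^ k) hGn hNn'
  haveI := hLfin
  haveI hHkfin : Finite (subgroupH1 Gn (WeierstrassCurve.geomTorsion W ((p ^ k : ℕ) : ℤ))) := Finite.of_equiv _ eqv.symm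
  have hHk : Nat.card (subgroupH1 Gn (WeierstrassCurve.geomTorsion W ((p ^ k : ℕ) : ℤ))) ≤ t ^ 2 := by
    rw [Nat.card_congr eqv]; exact hLup
  -- exact Kummer count at `G_n ≤ D_v ≤ Γ_K`
  set ι : subgroupH1 Gn (geomTorsion W ((p ^ k : ℕ) : ℤ)) →+ subgroupH1 Gn A :=
    resH1Hom (ContinuousMonoidHom.id Gn) (AddSubgroup.inclusion (geomTorsion_pow_le_geomPrimaryTorsion W p k))
      (fun _ _ ↦ rfl) with hιdef
  have e : ι.range ≃ {x : subgroupH1 Gn A // p ^ k • x = 0} := by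
    refine Equiv.subtypeEquivRight fun x ↦ ⟨?_, fun hx ↦ ?_⟩
    · rintro ⟨y, rfl⟩
      exact UniversalToricDescentKummerPow.pow_smul_resH1Hom_torsionPow_nested_eq_zero W p Gn k y
    · exact UniversalToricDescentKummerPow.exists_resH1Hom_torsionPow_eq_nested W p Gn k hx
  haveI : Finite ι.range := Finite.of_surjective _ ι.rangeRestrict_surjective
  have hrange : Nat.card (subgroupH1 Gn (geomTorsion W ((p ^ k : ℕ) : ℤ))) = Nat.card ι.range * Nat.card ι.ker := by
    rw [AddSubgroup.card_eq_card_quotient_mul_card_addSubgroup ι.ker,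
      Nat.card_congr (QuotientAddGroup.quotientKerEquivRange ι).toEquiv]
  have hker : Nat.card ι.ker = t := by
    rw [hιdef, UniversalToricDescentKummerPow.natCard_ker_kummerPow_eq_natCard_quotient W p Gn k,
      UniversalToricDescentLocalKummer.natCard_quotient_eq_natCard_pTorsion_of_finite (B := B) (p ^ k), ht]
    exact Nat.card_congr (Equiv.subtypeEquivRight fun a ↦ by rw [AddMonoidHom.mem_ker]; rfl)
  refine ⟨Finite.of_equiv _ e, ?_⟩
  -- assemble: `#H¹(G_n, A)[p^k] · t = #H¹(G_n, E[p^k]) ≤ t²`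
  rw [← Nat.card_congr e]
  refine Nat.le_of_mul_le_mul_right ?_ htpos
  calc Nat.card ι.range * t = Nat.card (subgroupH1 Gn (geomTorsion W ((p ^ k : ℕ) : ℤ))) := by rw [hrange, hker]
    _ ≤ t ^ 2 := hHk
    _ = t * t := sq t

end Summit.BirchSwinnertonDyer.BirchSwinnertonDyer.Theorems.UniversalToricDescentTameLayerCount

end
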